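import Mathlib.Analysis.InnerProductSpace.PiL2
import Mathlib.Analysis.Normed.Module.FiniteDimension
import Mathlib.Topology.MetricSpace.Lipschitz
import Mathlib.Topology.MetricSpace.ProperSpace
import Literature.Analysis.FunctionSpaces.EquicontinuousSubsequence
import Literature.Analysis.FluidPDE.DistributionalEulerOfUniformLimit

/-!
# Arzelà–Ascoli for uniformly Lipschitz comparison flows (regular-condensate theorem, stub RC-AA)

Crux `TwoAndHalfD.TwohalfdNeg` (stmt-AnomalousDissipation-0211), line
`log-kantorovich-enstrophy-transfer`, regular-condensate theorem (lead c7), stub RC-AA.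

A sequence of space–time fields `W k : ℝ → T² → ℝ²` (`T² = UnitAddTorus (Fin 2)`, sup metric on
`ℝ × T²`), uniformly bounded by `L`, uniformly `L`-Lipschitz in `(t, x)` and weakly divergence free
at every time, has a subsequence converging UNIFORMLY on `[0, S] × T²` to a field `W'` with the
same three properties.  The limit is produced on `[0, S] × T²` and extended to all of `ℝ` by
clamping the time variable to `[0, S]` (`Set.projIcc`, which is `1`-Lipschitz, so the Lipschitz
constant, the bound and weak incompressibility are all kept).

Proof: the tree's sequential Arzelà–Ascoli theorem on a totally bounded set
(`Literature.Analysis.FunctionSpaces.exists_subseq_tendstoUniformlyOn_of_equicontinuous`, Rudin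
Thm. 7.25) on the compact set `Icc 0 S ×ˢ univ ⊆ ℝ × T²` with values in the compact ball
`closedBall 0 L ⊆ ℝ²`, equicontinuity coming from the uniform Lipschitz bound; Lipschitz bounds
and norm bounds pass to pointwise limits (`le_of_tendsto'`), and weak incompressibility passes to
uniform limits on `[0, S] × T²` (`Literature.Analysis.FluidPDE.Torus.isWeaklyDivFree_of_unifLimit`).

* `stub_rcArzelaAscoli` — the registered stub (last declaration).

Supports stmt-AnomalousDissipation-0211.  Sources: W. Rudin, *Principles of Mathematical
Analysis*, Thm. 7.25 (Arzelà–Ascoli); R. Temam, *Navier–Stokes Equations*, Ch. I §1.4 (weakly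
divergence-free fields).  Not here: any compactness in weaker topologies (stub RC-WL).
-/

namespace Summit.AnomalousDissipation.AnomalousDissipation.Theorems.TwohalfdNeg.RegularCondensate

open MeasureTheory Filter Topology
open scoped ENNReal NNReal InnerProductSpace
open Literature.Analysis.FunctionSpaces Literature.Analysis.FluidPDE

-- single-problem summit: the namespace `Summit.AnomalousDissipation.AnomalousDissipation.…` repeats a
-- segment by design (CONVENTIONS §1), which the `dupNamespace` linter would flag on every decl.
set_option linter.dupNamespace false

/-- **RC-AA — compactness of uniformly Lipschitz comparison flows.** A sequence of space–time
fields on `ℝ × T²`, uniformly bounded by `L`, uniformly `L`-Lipschitz in `(t, x)` (sup metric on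
`ℝ × T²`) and weakly divergence free at every time, has a subsequence converging uniformly on
`[0, S] × T²` to a field with the same three properties, defined on all of `ℝ` by clamping `t` to
`[0, S]`.  Arzelà–Ascoli (Rudin, *Principles*, Thm. 7.25) on the compact `Icc 0 S × T²` with
values in the compact ball of radius `L`; Lipschitz bounds and `∫ ⟪W, ∇θ⟫ = 0` pass to uniform
limits (Temam, Ch. I §1.4). [folklore] -/
theorem stub_rcArzelaAscoli :
    ∀ (L : ℝ≥0) (S : ℝ) (W : ℕ → ℝ → UnitAddTorus (Fin 2) → EuclideanSpace ℝ (Fin 2)), 0 < S →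
      (∀ k, LipschitzWith L (Function.uncurry (W k))) → (∀ k t x, ‖W k t x‖ ≤ L) →
      (∀ k t, Torus.IsWeaklyDivFree (W k t)) →
      ∃ (φ : ℕ → ℕ) (W' : ℝ → UnitAddTorus (Fin 2) → EuclideanSpace ℝ (Fin 2)), StrictMono φ ∧
        LipschitzWith L (Function.uncurry W') ∧ (∀ t x, ‖W' t x‖ ≤ L) ∧
        (∀ t, Torus.IsWeaklyDivFree (W' t)) ∧
        ∀ δ : ℝ, 0 < δ → ∀ᶠ n in atTop, ∀ t ∈ Set.Icc 0 S, ∀ x, ‖W (φ n) t x - W' t x‖ ≤ δ := by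
  intro L S W hS hLip hbd hdiv
  -- Arzelà–Ascoli on the compact `Icc 0 S ×ˢ univ` with values in the compact ball of radius `L`
  set K : Set (EuclideanSpace ℝ (Fin 2)) := Metric.closedBall 0 L
  have hK : IsCompact K := isCompact_closedBall _ _
  set D : Set (ℝ × UnitAddTorus (Fin 2)) := Set.Icc 0 S ×ˢ Set.univ
  have hD : TotallyBounded D := (isCompact_Icc.prod isCompact_univ).totallyBounded
  have hfK : ∀ i, ∀ p ∈ D, Function.uncurry (W i) p ∈ K := fun i p _ =>
    mem_closedBall_zero_iff.2 (hbd i p.1 p.2)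
  have hequi : ∀ ε > (0 : ℝ), ∃ δ > (0 : ℝ), ∀ i, ∀ p ∈ D, ∀ q ∈ D,
      dist p q < δ → dist (Function.uncurry (W i) p) (Function.uncurry (W i) q) ≤ ε := by
    intro ε hε
    refine ⟨ε / (L + 1), by positivity, fun i p _ q _ hpq => ?_⟩
    have hL0 : (0 : ℝ) ≤ L := L.coe_nonneg
    calc dist (Function.uncurry (W i) p) (Function.uncurry (W i) q)
        ≤ L * dist p q := (hLip i).dist_le_mul p q
      _ ≤ L * (ε / (L + 1)) := by gcongr
      _ ≤ ε := by
          rw [mul_div_assoc', div_le_iff₀ (by positivity)]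
          nlinarith
  obtain ⟨φ, hφ, g, hg⟩ :=
    exists_subseq_tendstoUniformlyOn_of_equicontinuous hD hK (fun i => Function.uncurry (W i))
      hfK hequi
  -- the clamp `c t ∈ [0, S]`, `1`-Lipschitz and the identity on `[0, S]`
  set c : ℝ → ℝ := fun t => ((Set.projIcc 0 S hS.le t : Set.Icc 0 S) : ℝ) with hc_def
  have hc_mem : ∀ t, c t ∈ Set.Icc 0 S := fun t => (Set.projIcc 0 S hS.le t).2
  have hc_of_mem : ∀ t ∈ Set.Icc 0 S, c t = t := fun t ht => by
    simp [hc_def, Set.projIcc_of_mem hS.le ht]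
  have hc_lip : ∀ t s, dist (c t) (c s) ≤ dist t s := fun t s => by
    have h := (LipschitzWith.projIcc hS.le).dist_le_mul t s
    rw [NNReal.coe_one, one_mul, Subtype.dist_eq] at h
    exact h
  have hmemD : ∀ t x, (c t, x) ∈ D := fun t x => Set.mk_mem_prod (hc_mem t) (Set.mem_univ _)
  have hpt : ∀ t x, Tendsto (fun n => W (φ n) (c t) x) atTop (𝓝 (g (c t, x))) := fun t x =>
    hg.tendsto_at (hmemD t x)
  -- uniform convergence on `[0, S] × T²`, in `ε`–`N` form
  have hunif : ∀ ε > (0 : ℝ), ∃ N : ℕ, ∀ q ≥ N, ∀ t ∈ Set.Icc 0 S, ∀ x,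
      ‖W (φ q) t x - g (t, x)‖ ≤ ε := by
    intro ε hε
    obtain ⟨N, hN⟩ := eventually_atTop.1 (Metric.tendstoUniformlyOn_iff.1 hg ε hε)
    refine ⟨N, fun q hq t ht x => ?_⟩
    have h := hN q hq (t, x) (Set.mk_mem_prod ht (Set.mem_univ _))
    rw [dist_comm, dist_eq_norm] at h
    exact h.le
  refine ⟨φ, fun t x => g (c t, x), hφ, ?_, ?_, ?_, ?_⟩
  · -- the Lipschitz bound passes to the pointwise limit; the clamp is `1`-Lipschitz
    refine LipschitzWith.of_dist_le_mul fun p q => ?_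
    obtain ⟨t, x⟩ := p
    obtain ⟨s, y⟩ := q
    simp only [Function.uncurry_apply_pair]
    refine le_of_tendsto' ((hpt t x).dist (hpt s y)) fun n => ?_
    calc dist (W (φ n) (c t) x) (W (φ n) (c s) y)
        = dist (Function.uncurry (W (φ n)) (c t, x)) (Function.uncurry (W (φ n)) (c s, y)) := rfl
      _ ≤ L * dist (c t, x) (c s, y) := (hLip (φ n)).dist_le_mul _ _
      _ ≤ L * dist (t, x) (s, y) := by
          gcongr
          simp only [Prod.dist_eq]
          exact max_le_max (hc_lip t s) le_rfl
  · -- the bound passes to the pointwise limit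
    intro t x
    exact le_of_tendsto' (hpt t x).norm fun n => hbd _ _ _
  · -- weak incompressibility passes to uniform limits on `[0, S] × T²`
    intro t
    have hvc : ∀ q, ContinuousOn (Torus.stLift (W (φ q))) (Set.Icc 0 S ×ˢ Set.univ) := fun q =>
      ((hLip (φ q)).continuous.comp
        (continuous_fst.prodMk (Torus.continuous_proj.comp continuous_snd))).continuousOn
    exact Torus.isWeaklyDivFree_of_unifLimit (u := fun t x => g (t, x)) hvc
      (fun q t _ => hdiv (φ q) t) hunif (hc_mem t)
  · -- uniform convergence on `[0, S] × T²`
    intro δ hδ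
    obtain ⟨N, hN⟩ := hunif δ hδ
    filter_upwards [eventually_ge_atTop N] with n hn t ht x
    simpa only [hc_of_mem t ht] using hN n hn t ht x

end Summit.AnomalousDissipation.AnomalousDissipation.Theorems.TwohalfdNeg.RegularCondensate
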